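import Mathlib
import HarnessLib
import Literature.NumberTheory.LFunctions.ZetaScrew
import Summits.RiemannHypothesis.RiemannHypothesis.Theorems.IntegerScrewIncrementSharp

/-!
# Route `IntegerScrew` — the ADJACENT-INCREMENT COVARIANCE of Kreĭn's screw line:
# `M·Cov(I_M, I_{M−1}) → −log 2` (PIVOT-LAW §2a(iv), DERIVED → THEOREM; RH-FREE)

For the screw line `x_t` of `Ψ = zetaScrew` (stationary increments, `‖x_t − x_s‖² = 2Ψ(t − s)`) the
increments over consecutive log-integer cells `I_M = x_{log M} − x_{log(M−1)}` have
`Cov(I_M, I_{M−1}) = Ψ(h_M + h_{M−1}) − Ψ(h_M) − Ψ(h_{M−1})`, `h_M = log(M/(M−1))`,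
`h_M + h_{M−1} = log(M/(M−2))` (PIVOT-LAW §2a(iv)).  From the two-term model of `Ψ` on the wall
(`IntegerScrewIncrementSharp.abs_zetaScrew_sub_leadingModel_le`: `|Ψ(t) − Λ(t)| ≤ 4t²`,
`2Λ(t) = t log(1/t) − c₀t`) we prove

* `abs_incrementCov_add_log_two_le` : for `M ≥ 6`,
  `|M·(Ψ(log(M/(M−2))) − Ψ(log(M/(M−1))) − Ψ(log((M−1)/(M−2)))) + log 2| ≤ 40/(M − 2)`;
* `tendsto_incrementCov` : `M·Cov(I_M, I_{M−1}) → −log 2`.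

So adjacent increments are negatively correlated with correlation `≈ −log 2/log M → 0` (the
«long memory, not local smoothness» remark of §2a(iv) rests on this number).  A statement about the
explicit function `Ψ` on `(0, log 2)`; nothing here bears on the truth of RH. [Suzuki2023, (1.1)]
-/

noncomputable section

-- D-0017: `Summit.<S>.<S>.…` is the designed namespace of a single-problem summit.
set_option linter.dupNamespace false

namespace Summit.RiemannHypothesis.RiemannHypothesis.Theorems.IntegerScrew

open Literature.NumberTheory.LFunctions Filter
open scoped Topology

/-- `1 − 1/x ≤ log x ≤ x − 1` packaged for `x = p/q`: for `p, q > 0`,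
`(p − q)/p ≤ log(p/q) ≤ (p − q)/q`. [folklore] -/
private theorem log_div_bounds {p q : ℝ} (hp : 0 < p) (hq : 0 < q) :
    (p - q) / p ≤ Real.log (p / q) ∧ Real.log (p / q) ≤ (p - q) / q := by
  have hx : 0 < p / q := div_pos hp hq
  constructor
  · have h := Real.one_sub_inv_le_log_of_pos hx
    rw [inv_div] at h
    have : 1 - q / p = (p - q) / p := by field_simp
    linarith
  · have h := Real.log_le_sub_one_of_pos hx
    have : p / q - 1 = (p - q) / q := by field_simp
    linarith

/-- The model's mixed difference: for `0 < a ≤ b`,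
`|(a+b)log(a+b) − a log a − b log b − (a+b) log 2| ≤ (3/2)(b − a)`. [folklore] -/
private theorem abs_mulLog_mixed_sub_le {a b : ℝ} (ha : 0 < a) (hab : a ≤ b) :
    |(a + b) * Real.log (a + b) - a * Real.log a - b * Real.log b - (a + b) * Real.log 2|
      ≤ 3 / 2 * (b - a) := by
  have hb : 0 < b := ha.trans_le hab
  have hab0 : 0 < a + b := by positivity
  -- rewrite as a·log((a+b)/(2a)) + b·log((a+b)/(2b))
  have h1 : (a + b) * Real.log (a + b) - a * Real.log a - b * Real.log b - (a + b) * Real.log 2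
      = a * Real.log ((a + b) / (2 * a)) + b * Real.log ((a + b) / (2 * b)) := by
    rw [Real.log_div hab0.ne' (by positivity), Real.log_div hab0.ne' (by positivity),
      Real.log_mul (by norm_num) ha.ne', Real.log_mul (by norm_num) hb.ne']
    ring
  rw [h1]
  obtain ⟨hA1, hA2⟩ := log_div_bounds (p := a + b) (q := 2 * a) hab0 (by positivity)
  obtain ⟨hB1, hB2⟩ := log_div_bounds (p := a + b) (q := 2 * b) hab0 (by positivity)
  -- a·log((a+b)/(2a)) ∈ [0, (b−a)/2]
  have hAlo : 0 ≤ a * Real.log ((a + b) / (2 * a)) :=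
    mul_nonneg ha.le (le_trans (div_nonneg (by linarith) hab0.le) hA1)
  have hAhi : a * Real.log ((a + b) / (2 * a)) ≤ (b - a) / 2 := by
    calc a * Real.log ((a + b) / (2 * a)) ≤ a * ((a + b - 2 * a) / (2 * a)) :=
          mul_le_mul_of_nonneg_left hA2 ha.le
      _ = (b - a) / 2 := by field_simp; ring
  -- b·log((a+b)/(2b)) ∈ [−(b−a), 0]
  have hBhi : b * Real.log ((a + b) / (2 * b)) ≤ 0 := by
    have : Real.log ((a + b) / (2 * b)) ≤ 0 :=
      hB2.trans (div_nonpos_of_nonpos_of_nonneg (by linarith) (by positivity))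
    nlinarith
  have hBlo : -(b - a) ≤ b * Real.log ((a + b) / (2 * b)) := by
    have h2 : b * ((a + b - 2 * b) / (a + b)) ≤ b * Real.log ((a + b) / (2 * b)) :=
      mul_le_mul_of_nonneg_left hB1 hb.le
    have h3 : -(b - a) ≤ b * ((a + b - 2 * b) / (a + b)) := by
      rw [show b * ((a + b - 2 * b) / (a + b)) = -((b - a) * (b / (a + b))) by ring]
      have : b / (a + b) ≤ 1 := by rw [div_le_one hab0]; linarith
      nlinarith
    linarith
  rw [abs_le]; constructor <;> linarith

/-- `|x − y + z| ≤ |x| + |y| + |z|`. [folklore] -/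
private theorem abs_add_three_le' (x y z : ℝ) : |x - y + z| ≤ |x| + |y| + |z| := by
  calc |x - y + z| ≤ |x - y| + |z| := abs_add_le _ _
    _ ≤ |x| + |y| + |z| := by linarith [abs_sub x y]

set_option maxHeartbeats 400000 in
/-- **Adjacent-increment covariance:
`|M·(Ψ(log(M/(M−2))) − Ψ(log(M/(M−1))) − Ψ(log((M−1)/(M−2)))) + log 2| ≤ 40/(M − 2)` for `M ≥ 6`.**
[folklore] -/
theorem abs_incrementCov_add_log_two_le (M : ℕ) (hM : 6 ≤ M) :
    |(M : ℝ) * (zetaScrew (Real.log ((M : ℝ) / ((M : ℝ) - 2)))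
        - zetaScrew (Real.log ((M : ℝ) / ((M : ℝ) - 1)))
        - zetaScrew (Real.log (((M : ℝ) - 1) / ((M : ℝ) - 2)))) + Real.log 2|
      ≤ 40 / ((M : ℝ) - 2) := by
  have hM6 : (6 : ℝ) ≤ M := by exact_mod_cast hM
  set m : ℝ := (M : ℝ) with hm
  have hm2 : 0 < m - 2 := by linarith
  have hm1 : 0 < m - 1 := by linarith
  have hm0 : 0 < m := by linarith
  -- the three lags
  set a : ℝ := Real.log (m / (m - 1)) with ha
  set b : ℝ := Real.log ((m - 1) / (m - 2)) with hb
  have hab_sum : Real.log (m / (m - 2)) = a + b := by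
    rw [ha, hb, ← Real.log_mul (div_pos hm0 hm1).ne' (div_pos hm1 hm2).ne']
    congr 1; field_simp
  rw [hab_sum]
  obtain ⟨ha1, ha2⟩ := log_div_bounds (p := m) (q := m - 1) hm0 hm1
  obtain ⟨hb1, hb2⟩ := log_div_bounds (p := m - 1) (q := m - 2) hm1 hm2
  rw [← ha] at ha1 ha2
  rw [← hb] at hb1 hb2
  have ha1' : 1 / m ≤ a := by rw [show m - (m - 1) = 1 by ring] at ha1; simpa using ha1
  have ha2' : a ≤ 1 / (m - 1) := by rw [show m - (m - 1) = 1 by ring] at ha2; exact ha2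
  have hb1' : 1 / (m - 1) ≤ b := by rw [show m - 1 - (m - 2) = 1 by ring] at hb1; exact hb1
  have hb2' : b ≤ 1 / (m - 2) := by rw [show m - 1 - (m - 2) = 1 by ring] at hb2; exact hb2
  have ha0 : 0 < a := lt_of_lt_of_le (by positivity) ha1'
  have hab : a ≤ b := ha2'.trans hb1'
  have hb0 : 0 < b := ha0.trans_le hab
  have hq : 1 / (m - 2) ≤ 1 / 4 := by
    rw [div_le_div_iff₀ hm2 (by norm_num)]; linarith
  have hbq : b ≤ 1 / 4 := hb2'.trans hq
  have habq : a + b ≤ 1 / 2 := by linarith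
  -- the two-term model at a, b, a+b
  set c₀ : ℝ := Real.log (2 * Real.pi) + Real.eulerMascheroniConstant - 1 with hc0
  have hΨa := abs_zetaScrew_sub_leadingModel_le ha0 (by linarith)
  have hΨb := abs_zetaScrew_sub_leadingModel_le hb0 (by linarith)
  have hΨab := abs_zetaScrew_sub_leadingModel_le (t := a + b) (by positivity) habq
  rw [← hc0] at hΨa hΨb hΨab
  -- the model's mixed difference
  have hmix := abs_mulLog_mixed_sub_le ha0 hab
  -- sizes: b − a ≤ 1/(m−2) − 1/m = 2/(m(m−2)); a, b, a+b ≤ 2/(m−2)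
  have hba : b - a ≤ 2 / (m * (m - 2)) := by
    have : 1 / (m - 2) - 1 / m = 2 / (m * (m - 2)) := by field_simp; ring
    linarith
  -- 2/m ≤ a + b ≤ 2/(m−2)
  have h12 : 1 / (m - 1) ≤ 1 / (m - 2) := one_div_le_one_div_of_le hm2 (by linarith)
  have h01 : 1 / m ≤ 1 / (m - 1) := one_div_le_one_div_of_le hm1 (by linarith)
  have hsum_lo : 2 / m ≤ a + b := by
    calc 2 / m = 1 / m + 1 / m := by ring
      _ ≤ a + b := add_le_add ha1' (h01.trans hb1')
  have hsum_hi : a + b ≤ 2 / (m - 2) := by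
    calc a + b ≤ 1 / (m - 1) + 1 / (m - 2) := add_le_add ha2' hb2'
      _ ≤ 1 / (m - 2) + 1 / (m - 2) := by gcongr
      _ = 2 / (m - 2) := by ring
  have hsq : (a + b) ^ 2 + a ^ 2 + b ^ 2 ≤ 6 / (m - 2) ^ 2 := by
    have h1 : a ≤ 1 / (m - 2) := ha2'.trans h12
    have h2 : 0 ≤ a := ha0.le
    have h3 : 0 ≤ b := hb0.le
    have e1 : (a + b) ^ 2 ≤ (2 / (m - 2)) ^ 2 := pow_le_pow_left₀ (by linarith) hsum_hi 2
    have e2 : a ^ 2 ≤ (1 / (m - 2)) ^ 2 := pow_le_pow_left₀ h2 h1 2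
    have e3 : b ^ 2 ≤ (1 / (m - 2)) ^ 2 := pow_le_pow_left₀ h3 hb2' 2
    have : (2 / (m - 2)) ^ 2 + (1 / (m - 2)) ^ 2 + (1 / (m - 2)) ^ 2 = 6 / (m - 2) ^ 2 := by
      field_simp; ring
    linarith
  -- main algebra: write the target as model part + three Ψ-errors
  have key : m * (zetaScrew (a + b) - zetaScrew a - zetaScrew b) + Real.log 2
      = m * ((zetaScrew (a + b) - (-((a + b) * Real.log (a + b)) - c₀ * (a + b)) / 2)
            - (zetaScrew a - (-(a * Real.log a) - c₀ * a) / 2)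
            - (zetaScrew b - (-(b * Real.log b) - c₀ * b) / 2))
        - m / 2 * ((a + b) * Real.log (a + b) - a * Real.log a - b * Real.log b
            - (a + b) * Real.log 2)
        + Real.log 2 * (1 - m * (a + b) / 2) := by ring
  rw [key]
  -- bound each piece
  have hlog2 : 0 < Real.log 2 := Real.log_pos (by norm_num)
  have hlog2' : Real.log 2 < 1 := by have := Real.log_two_lt_d9; linarith
  have h1 : |m * ((zetaScrew (a + b) - (-((a + b) * Real.log (a + b)) - c₀ * (a + b)) / 2)
            - (zetaScrew a - (-(a * Real.log a) - c₀ * a) / 2)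
            - (zetaScrew b - (-(b * Real.log b) - c₀ * b) / 2))| ≤ m * (24 / (m - 2) ^ 2) := by
    rw [abs_mul, abs_of_pos hm0]
    refine mul_le_mul_of_nonneg_left ?_ hm0.le
    calc |zetaScrew (a + b) - (-((a + b) * Real.log (a + b)) - c₀ * (a + b)) / 2
            - (zetaScrew a - (-(a * Real.log a) - c₀ * a) / 2)
            - (zetaScrew b - (-(b * Real.log b) - c₀ * b) / 2)|
          ≤ |zetaScrew (a + b) - (-((a + b) * Real.log (a + b)) - c₀ * (a + b)) / 2|
            + |zetaScrew a - (-(a * Real.log a) - c₀ * a) / 2|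
            + |zetaScrew b - (-(b * Real.log b) - c₀ * b) / 2| := by
            refine (abs_sub _ _).trans ?_
            refine add_le_add ((abs_sub _ _).trans le_rfl) le_rfl
      _ ≤ 4 * (a + b) ^ 2 + 4 * a ^ 2 + 4 * b ^ 2 := by linarith [hΨa, hΨb, hΨab]
      _ ≤ 24 / (m - 2) ^ 2 := by
            have : 4 * (a + b) ^ 2 + 4 * a ^ 2 + 4 * b ^ 2 = 4 * ((a + b) ^ 2 + a ^ 2 + b ^ 2) := by
              ring
            rw [this]
            calc 4 * ((a + b) ^ 2 + a ^ 2 + b ^ 2) ≤ 4 * (6 / (m - 2) ^ 2) := by gcongr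
              _ = 24 / (m - 2) ^ 2 := by ring
  have h2 : |m / 2 * ((a + b) * Real.log (a + b) - a * Real.log a - b * Real.log b
            - (a + b) * Real.log 2)| ≤ 3 / 2 * (1 / (m - 2)) := by
    rw [abs_mul, abs_of_pos (by positivity)]
    calc m / 2 * |(a + b) * Real.log (a + b) - a * Real.log a - b * Real.log b - (a + b) * Real.log 2|
        ≤ m / 2 * (3 / 2 * (b - a)) := mul_le_mul_of_nonneg_left hmix (by positivity)
      _ ≤ m / 2 * (3 / 2 * (2 / (m * (m - 2)))) := by gcongr
      _ = 3 / 2 * (1 / (m - 2)) := by field_simp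
  have h3 : |Real.log 2 * (1 - m * (a + b) / 2)| ≤ 2 / (m - 2) := by
    rw [abs_mul, abs_of_pos hlog2]
    have hlo : -(2 / (m - 2)) ≤ 1 - m * (a + b) / 2 := by
      have : m * (a + b) / 2 ≤ m * (2 / (m - 2)) / 2 := by gcongr
      have h' : m * (2 / (m - 2)) / 2 = 1 + 2 / (m - 2) := by field_simp; ring
      linarith
    have hhi : 1 - m * (a + b) / 2 ≤ 0 := by
      have : m * (2 / m) / 2 ≤ m * (a + b) / 2 := by gcongr
      have h' : m * (2 / m) / 2 = 1 := by field_simp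
      linarith
    calc Real.log 2 * |1 - m * (a + b) / 2| ≤ 1 * (2 / (m - 2)) := by
          refine mul_le_mul hlog2'.le ?_ (abs_nonneg _) (by norm_num)
          rw [abs_le]; constructor <;> linarith
      _ = 2 / (m - 2) := one_mul _
  -- assemble: m·24/(m−2)² ≤ 36/(m−2) since m/(m−2) ≤ 3/2
  have hmm : m / (m - 2) ≤ 3 / 2 := by rw [div_le_iff₀ hm2]; linarith
  have h1' : m * (24 / (m - 2) ^ 2) ≤ 36 / (m - 2) := by
    have : m * (24 / (m - 2) ^ 2) = 24 * (m / (m - 2)) * (1 / (m - 2)) := by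
      field_simp
    rw [this]
    have h1m : 0 < 1 / (m - 2) := by positivity
    calc 24 * (m / (m - 2)) * (1 / (m - 2)) ≤ 24 * (3 / 2) * (1 / (m - 2)) := by gcongr
      _ = 36 / (m - 2) := by ring
  calc |m * ((zetaScrew (a + b) - (-((a + b) * Real.log (a + b)) - c₀ * (a + b)) / 2)
            - (zetaScrew a - (-(a * Real.log a) - c₀ * a) / 2)
            - (zetaScrew b - (-(b * Real.log b) - c₀ * b) / 2))
        - m / 2 * ((a + b) * Real.log (a + b) - a * Real.log a - b * Real.log b
            - (a + b) * Real.log 2)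
        + Real.log 2 * (1 - m * (a + b) / 2)|
      ≤ |m * ((zetaScrew (a + b) - (-((a + b) * Real.log (a + b)) - c₀ * (a + b)) / 2)
            - (zetaScrew a - (-(a * Real.log a) - c₀ * a) / 2)
            - (zetaScrew b - (-(b * Real.log b) - c₀ * b) / 2))|
        + |m / 2 * ((a + b) * Real.log (a + b) - a * Real.log a - b * Real.log b
            - (a + b) * Real.log 2)|
        + |Real.log 2 * (1 - m * (a + b) / 2)| := abs_add_three_le' _ _ _
    _ ≤ 36 / (m - 2) + 3 / 2 * (1 / (m - 2)) + 2 / (m - 2) := by linarith [h1, h1', h2, h3]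
    _ ≤ 40 / (m - 2) := by
        have h1m : 0 < 1 / (m - 2) := by positivity
        have : 36 / (m - 2) + 3 / 2 * (1 / (m - 2)) + 2 / (m - 2) = (79 / 2) * (1 / (m - 2)) := by
          ring
        rw [this, div_eq_mul_one_div 40]
        nlinarith

/-- **`M·Cov(I_M, I_{M−1}) → −log 2`**: adjacent increments of the screw line over consecutive
log-integer cells are asymptotically negatively correlated with `M·Cov → −log 2`
(PIVOT-LAW §2a(iv)). [folklore] -/
theorem tendsto_incrementCov :
    Tendsto (fun M : ℕ => (M : ℝ) * (zetaScrew (Real.log ((M : ℝ) / ((M : ℝ) - 2)))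
        - zetaScrew (Real.log ((M : ℝ) / ((M : ℝ) - 1)))
        - zetaScrew (Real.log (((M : ℝ) - 1) / ((M : ℝ) - 2))))) atTop (𝓝 (-Real.log 2)) := by
  have h1 : Tendsto (fun M : ℕ => (M : ℝ) - 2) atTop atTop := by
    simpa [sub_eq_add_neg] using
      tendsto_atTop_add_const_right atTop (-2 : ℝ) (tendsto_natCast_atTop_atTop (R := ℝ))
  have hlim : Tendsto (fun M : ℕ => 40 / ((M : ℝ) - 2)) atTop (𝓝 0) :=
    tendsto_const_nhds.div_atTop h1
  rw [tendsto_iff_norm_sub_tendsto_zero]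
  refine squeeze_zero' (Eventually.of_forall fun _ => norm_nonneg _) ?_ hlim
  filter_upwards [eventually_ge_atTop 6] with M hM
  rw [Real.norm_eq_abs, sub_neg_eq_add]
  exact abs_incrementCov_add_log_two_le M hM

end Summit.RiemannHypothesis.RiemannHypothesis.Theorems.IntegerScrew
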